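import Literature.NumberTheory.ModularForms.LevelOneHeckeSturmGenerators
import HarnessLib

/-!
# `dim S_k(SL₂(ℤ)) = ⌊k/12⌋ − 1` if `k ≡ 2 (mod 12)`, `= ⌊k/12⌋` otherwise (`k ≥ 4` even; Serre VII §3.2 Thm. 4)

J.-P. Serre, *A Course in Arithmetic*, Ch. VII §3.2, Thm. 4 and Cor. 1–2 (held `book:serre1973-course-arithmetic`,
p0088 in Serre's numbering of weights `2k`): "`dim M_k = [k/12]` if `k ≡ 2 (mod 12)`, `[k/12] + 1` if
`k ≢ 2 (mod 12)`", "`M_k = M_k⁰ ⊕ C·G_k`" — hence `dim S_k = dim M_k − 1` for `k ≥ 4`. F. Diamond, J. Shurman, *A First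
Course in Modular Forms*, Thm. 3.5.2 (the same formulas for `SL₂(ℤ)`).  Mathlib has the `M_k` formula
(`ModularForm.dimension_level_one`) and `dim M_k = 1 + dim S_k` (`ModularForm.rank_eq_one_add_rank_cuspForm`); the
tree has `dim M_w = serreCard w` and `dim S_w + 1 = serreCard w` (`finrank_cuspForm_add_one_eq_serreCard`,
`LevelOneHeckeSturmGenerators`).  This file records the closed formula for cusp forms and the resulting small-weight
dimension bounds (used with the Hecke-ring generation theorems of `LevelOneHeckeRingPrimeGenerators`):

* ★ **`finrank_cuspForm_levelOne`**: for even `k ≥ 4`,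
  `dim S_k(SL₂(ℤ)) = if k % 12 = 2 then k/12 − 1 else k/12`; `finrank_cuspForm_levelOne_of_odd`,
  `finrank_cuspForm_levelOne_of_lt_twelve` (`= 0`); the values `dim S₃₆ = 3`, `dim S₄₈ = 4`;
* `finrank_cuspForm_le_one_of_weight` (`k ≤ 22` or `k = 26`), `finrank_cuspForm_le_two_of_weight` (`k ≤ 34` or
  `k = 38`), `finrank_cuspForm_le_three_of_weight` (`k ≤ 46` or `k = 50`).

No named facts; no new definitions.

## References

* [Serre1973] J.-P. Serre, *A Course in Arithmetic*, GTM 7 (1973), Ch. VII §3.2 Thm. 4, Cor. 1–2; §5.5.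
* [DiamondShurman2005] F. Diamond, J. Shurman, *A First Course in Modular Forms*, GTM 228, Thm. 3.5.2.
-/

noncomputable section

open scoped MatrixGroups ModularForm
open UpperHalfPlane hiding I

namespace Literature.NumberTheory.ModularForms

/-! ## §1 The dimension formula for `S_k(SL₂(ℤ))` -/

section Dimension

/-- ★ **`dim S_k(SL₂(ℤ)) = ⌊k/12⌋ − 1` if `k ≡ 2 (mod 12)` and `= ⌊k/12⌋` otherwise, for even `k ≥ 4`.**
[cite: Serre1973, Ch. VII §3.2 Thm. 4 and Cor. 2] [cite: DiamondShurman2005, Thm. 3.5.2] -/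
theorem finrank_cuspForm_levelOne {k : ℕ} (hk : Even k) (h4 : 4 ≤ k) :
    Module.finrank ℂ (CuspForm 𝒮ℒ (k : ℤ)) = if k % 12 = 2 then k / 12 - 1 else k / 12 := by
  have h := finrank_cuspForm_add_one_eq_serreCard hk (by omega)
  unfold serreCard at h
  split_ifs at h ⊢ <;> omega

/-- `dim S_k(SL₂(ℤ)) = 0` for odd `k`. [cite: Serre1973, Ch. VII §3.2] -/
theorem finrank_cuspForm_levelOne_of_odd {k : ℤ} (hk : Odd k) : Module.finrank ℂ (CuspForm 𝒮ℒ k) = 0 := by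
  haveI := finiteDimensional_cuspForm_levelOne k
  exact finrank_zero_iff_forall_zero.mpr (cuspForm_eq_zero_of_odd hk)

/-- `dim S_k(SL₂(ℤ)) = 0` for `k < 12`. [cite: Serre1973, Ch. VII §3.2 Thm. 4 (ii)] -/
theorem finrank_cuspForm_levelOne_of_lt_twelve {k : ℤ} (hk : k < 12) : Module.finrank ℂ (CuspForm 𝒮ℒ k) = 0 := by
  haveI := finiteDimensional_cuspForm_levelOne k
  exact finrank_zero_iff_forall_zero.mpr (cuspForm_eq_zero_of_weight_lt_twelve hk)

/-- **`dim S_k(SL₂(ℤ)) ≤ ⌊k/12⌋` with equality unless `k ≡ 2 (mod 12)`** (even `k ≥ 4`).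
[cite: Serre1973, Ch. VII §3.2 Cor. 2] -/
theorem finrank_cuspForm_levelOne_eq_div_of_mod_ne {k : ℕ} (hk : Even k) (h4 : 4 ≤ k) (hmod : k % 12 ≠ 2) :
    Module.finrank ℂ (CuspForm 𝒮ℒ (k : ℤ)) = k / 12 := by
  rw [finrank_cuspForm_levelOne hk h4, if_neg hmod]

/-- `dim S_k(SL₂(ℤ)) = ⌊k/12⌋ − 1` when `k ≡ 2 (mod 12)`. [cite: Serre1973, Ch. VII §3.2 Cor. 2] -/
theorem finrank_cuspForm_levelOne_eq_div_sub_one_of_mod_eq {k : ℕ} (hk : Even k) (h4 : 4 ≤ k) (hmod : k % 12 = 2) :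
    Module.finrank ℂ (CuspForm 𝒮ℒ (k : ℤ)) = k / 12 - 1 := by
  rw [finrank_cuspForm_levelOne hk h4, if_pos hmod]

/-- `dim S₃₆(SL₂(ℤ)) = 3`. [cite: Serre1973, Ch. VII §3.2 Cor. 2] -/
theorem finrank_cuspForm_thirtySix : Module.finrank ℂ (CuspForm 𝒮ℒ 36) = 3 := by
  have h := finrank_cuspForm_levelOne (k := 36) ⟨18, rfl⟩ (by norm_num)
  norm_num at h
  exact h

/-- `dim S₄₈(SL₂(ℤ)) = 4`. [cite: Serre1973, Ch. VII §3.2 Cor. 2] -/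
theorem finrank_cuspForm_fortyEight : Module.finrank ℂ (CuspForm 𝒮ℒ 48) = 4 := by
  have h := finrank_cuspForm_levelOne (k := 48) ⟨24, rfl⟩ (by norm_num)
  norm_num at h
  exact h

/-- **`dim S_k(SL₂(ℤ)) ≤ 1` for `k ≤ 22` and for `k = 26`.** [cite: Serre1973, Ch. VII §3.2 Cor. 2 and §5.5] -/
theorem finrank_cuspForm_le_one_of_weight {k : ℤ} (hk : k ≤ 22 ∨ k = 26) : Module.finrank ℂ (CuspForm 𝒮ℒ k) ≤ 1 := by
  rcases Int.even_or_odd k with heven | hodd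
  · rcases lt_or_ge k 12 with h12 | h12
    · rw [finrank_cuspForm_levelOne_of_lt_twelve h12]
      exact Nat.zero_le _
    · have hk0 : 0 ≤ k := by omega
      lift k to ℕ using hk0
      have hk' : Even k := by
        obtain ⟨m, hm⟩ := heven
        exact (Int.even_coe_nat k).mp ⟨m, hm⟩
      rw [finrank_cuspForm_levelOne hk' (by omega)]
      split_ifs <;> omega
  · rw [finrank_cuspForm_levelOne_of_odd hodd]
    exact Nat.zero_le _

/-- **`dim S_k(SL₂(ℤ)) ≤ 2` for `k ≤ 34` and for `k = 38`.** [cite: Serre1973, Ch. VII §3.2 Cor. 2] -/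
theorem finrank_cuspForm_le_two_of_weight {k : ℤ} (hk : k ≤ 34 ∨ k = 38) : Module.finrank ℂ (CuspForm 𝒮ℒ k) ≤ 2 := by
  rcases Int.even_or_odd k with heven | hodd
  · rcases lt_or_ge k 12 with h12 | h12
    · rw [finrank_cuspForm_levelOne_of_lt_twelve h12]
      exact Nat.zero_le _
    · have hk0 : 0 ≤ k := by omega
      lift k to ℕ using hk0
      have hk' : Even k := by
        obtain ⟨m, hm⟩ := heven
        exact (Int.even_coe_nat k).mp ⟨m, hm⟩
      rw [finrank_cuspForm_levelOne hk' (by omega)]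
      split_ifs <;> omega
  · rw [finrank_cuspForm_levelOne_of_odd hodd]
    exact Nat.zero_le _

/-- **`dim S_k(SL₂(ℤ)) ≤ 3` for `k ≤ 46` and for `k = 50`.** [cite: Serre1973, Ch. VII §3.2 Cor. 2] -/
theorem finrank_cuspForm_le_three_of_weight {k : ℤ} (hk : k ≤ 46 ∨ k = 50) :
    Module.finrank ℂ (CuspForm 𝒮ℒ k) ≤ 3 := by
  rcases Int.even_or_odd k with heven | hodd
  · rcases lt_or_ge k 12 with h12 | h12
    · rw [finrank_cuspForm_levelOne_of_lt_twelve h12]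
      exact Nat.zero_le _
    · have hk0 : 0 ≤ k := by omega
      lift k to ℕ using hk0
      have hk' : Even k := by
        obtain ⟨m, hm⟩ := heven
        exact (Int.even_coe_nat k).mp ⟨m, hm⟩
      rw [finrank_cuspForm_levelOne hk' (by omega)]
      split_ifs <;> omega
  · rw [finrank_cuspForm_levelOne_of_odd hodd]
    exact Nat.zero_le _

end Dimension

end Literature.NumberTheory.ModularForms
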